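import Literature.IUT.HodgeTheaters.TemperedGraphGroupDataOfProp36
import Literature.IUT.HodgeTheaters.TemperedCoveringsByNameAt
import Literature.AnabelianGeometry.SemiGraphs.TemperedGaloisDomination
import Literature.AnabelianGeometry.SemiGraphs.TemperedVerticialNamedFactsProofs
import HarnessLib

/-!
# [IUTchI] Prop. 2.1 / 2.2 for the CANONICAL 𝔾-data of a graph of anabelioids: every [SemiAnbd] input
# by name except Thm. 3.7 (iii) (at `𝒢`) and [NodNon] Lem. 1.9 (ii)

Mochizuki, *Inter-universal Teichmüller theory I*, kurims manuscript (May 2020), §2, Prop. 2.1 / 2.2 p. 45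
[cite: Mochizuki2012, Prop 2.1 p.45] (D-0012 claim key; nothing of the series is asserted here), over
[SemiAnbd] Prop. 3.6 / Thm. 3.7 [cite: MochizukiSemiAnbd2006, Prop 3.6 p.38].  PROOF-ONLY assembly (abc-iut
L3-t7, under L5-lead RULINGS #25 (1)): abc-iut-L5-t11's `prop21_of_chart_of_isProfiniteCompletion_at` /
`tp_isCommensurablyTerminal_of_chart_of_isProfiniteCompletion_at` (`TemperedCoveringsByNameAt.lean`)
instantiated at the canonical data `TemperedGraphGroupData.ofProp36` (`TemperedGraphGroupDataOfProp36.lean`: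
`Π^tp_𝔾 := π₁^temp(𝒢)`, `Π̂_𝔾 :=` its profinite completion), with the inputs supplied BY NAME:
chart `c := 𝒢.temperedPiChart h36` (Prop. 3.6 (i)(ii), abc-iut-L3-t9), `e := refl`, `hPC`
(`ofProp36_isProfiniteCompletion`, Prop. 3.6 (iii)), `hGal` (`galoisDomination_of_prop36`), `hVI`
(`verticialInjective_holds`, Thm. 3.7 (i)), and `hΛv` in the chart's own currency.  REMAINING hypotheses,
verbatim: `hCV : CompactInVerticialAt 𝒢` (Thm. 3.7 (iii) at `𝒢`, the φ2 producer programme), the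
verticial family `Λv` with `hΛv` (any family of verticial subgroups; one exists by
`exists_verticialFamily_of_prop36`), and the node data `src/tgt/c₁/c₂` with (A3) = [NodNon] Lem. 1.9 (ii)
(`hA3`).  Typed ≠ discharged; nothing here bears on [IUTchIII] Cor. 3.12.
-/

noncomputable section

namespace Literature.IUT.HodgeTheaters

open CategoryTheory
open scoped Pointwise
open Literature.AnabelianGeometry.SemiGraphs Literature.AnabelianGeometry.SemiGraphs.ProfiniteSemiGraph
open Literature.AnabelianGeometry.AbsoluteAnabelian (IsCommensurablyTerminal)

universe u

namespace TemperedGraphGroupData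

variable (𝒢 : ProfiniteSemiGraph.{u}) (h37 : 𝒢.Thm37Hypotheses)
  (Sigma SigmaHat : Set ℕ) (hsub : Sigma ⊆ SigmaHat) (hne : Sigma.Nonempty)
  (hprime : ∀ p ∈ SigmaHat, p.Prime)
  (TpH : Subgroup (𝒢.temperedPiChart h37.toProp36Hypotheses).G)
  (HatH : Subgroup
    (exists_completion_of_prop36 𝒢 h37.toProp36Hypotheses (𝒢.temperedPiChart h37.toProp36Hypotheses)).choose)
  (hle : TpH.map
    (exists_completion_of_prop36 𝒢 h37.toProp36Hypotheses
      (𝒢.temperedPiChart h37.toProp36Hypotheses)).choose_spec.choose.toMonoidHom ≤ HatH)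

/-- The identification `e : Π^tp_𝔾 ≃ₜ* (𝒢.temperedPiChart h36).G` used for the canonical data: the identity
(`ContinuousMulEquiv.refl`, read at the definitionally equal types). Mapping a subgroup along it is the
identity. [cite: MochizukiSemiAnbd2006, Thm 3.7(i) p.40] -/
theorem map_reflEquiv_ofProp36
    (H : Subgroup (ofProp36 𝒢 h37.toProp36Hypotheses Sigma SigmaHat hsub hne hprime TpH HatH hle).Tp) :
    H.map ((@id ((ofProp36 𝒢 h37.toProp36Hypotheses Sigma SigmaHat hsub hne hprime TpH HatH hle).Tp ≃ₜ*
          (𝒢.temperedPiChart h37.toProp36Hypotheses).G) (ContinuousMulEquiv.refl _) :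
        (ofProp36 𝒢 h37.toProp36Hypotheses Sigma SigmaHat hsub hne hprime TpH HatH hle).Tp →*
          (𝒢.temperedPiChart h37.toProp36Hypotheses).G)) = H := by
  ext x
  constructor
  · rintro ⟨y, hy, rfl⟩
    exact hy
  · intro hx
    exact ⟨x, hx, rfl⟩

/-- **[IUTchI] Prop. 2.1 for the canonical 𝔾-data `ofProp36`**, with `c`, `e`, `hPC`, `hGal` by name:
conditional exactly on Thm. 3.7 (iii) at `𝒢` (`hCV`), a family of verticial subgroups (`Λv`, `hΛv`, in the
chart's currency) and the node data with (A3) (`hA3`). ([IUTchI] Prop 2.1 p.45) [claim: Mochizuki2012, status: disputed] -/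
theorem prop21_ofProp36_at (hCV : CompactInVerticialAt 𝒢)
    (Λv : 𝒢.graph.Vertex →
      Subgroup (ofProp36 𝒢 h37.toProp36Hypotheses Sigma SigmaHat hsub hne hprime TpH HatH hle).Tp)
    (hΛv : ∀ v, Λv v ∈ verticialSubgroups (𝒢.temperedPiChart h37.toProp36Hypotheses) v)
    {E : Type*} (src tgt : E → 𝒢.graph.Vertex)
    (c₁ c₂ : E → (ofProp36 𝒢 h37.toProp36Hypotheses Sigma SigmaHat hsub hne hprime TpH HatH hle).Tp)
    (hA3 : letI D := ofProp36 𝒢 h37.toProp36Hypotheses Sigma SigmaHat hsub hne hprime TpH HatH hle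
      ∀ (v w : 𝒢.graph.Vertex) (g h : D.Hat),
      MulAut.conj g • (Λv v).map D.ι ⊓ MulAut.conj h • (Λv w).map D.ι ≠ ⊥ →
        (v = w ∧ g⁻¹ * h ∈ (Λv v).map D.ι) ∨
        ∃ (e : E) (k : D.Hat), ∃ p ∈ (Λv (src e)).map D.ι, ∃ q ∈ (Λv (tgt e)).map D.ι,
          (src e = v ∧ tgt e = w ∧ g = k * D.ι (c₁ e) * p ∧ h = k * D.ι (c₂ e) * q) ∨
          (src e = w ∧ tgt e = v ∧ h = k * D.ι (c₁ e) * p ∧ g = k * D.ι (c₂ e) * q)) :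
    (ofProp36 𝒢 h37.toProp36Hypotheses Sigma SigmaHat hsub hne hprime TpH HatH hle).ProfiniteConjugatesOfCompactSubgroups :=
  (ofProp36 𝒢 h37.toProp36Hypotheses Sigma SigmaHat hsub hne hprime TpH HatH hle).prop21_of_chart_of_isProfiniteCompletion_at
    (𝒢.temperedPiChart h37.toProp36Hypotheses)
    (@id ((ofProp36 𝒢 h37.toProp36Hypotheses Sigma SigmaHat hsub hne hprime TpH HatH hle).Tp ≃ₜ*
      (𝒢.temperedPiChart h37.toProp36Hypotheses).G) (ContinuousMulEquiv.refl _)) h37 hCV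
    (ofProp36_isProfiniteCompletion 𝒢 h37.toProp36Hypotheses Sigma SigmaHat hsub hne hprime TpH HatH hle)
    (galoisDomination_of_prop36 h37.toProp36Hypotheses) Λv
    (fun v => by
      rw [map_reflEquiv_ofProp36 𝒢 h37 Sigma SigmaHat hsub hne hprime TpH HatH hle (Λv v)]
      exact hΛv v) src tgt c₁ c₂ hA3

/-- **[IUTchI] Prop. 2.2, "in particular `Π^tp_𝔾` is commensurably terminal in `Π̂_𝔾`", for the canonical
𝔾-data `ofProp36`**, with `c`, `e`, `hPC`, `hGal`, `hVI` (`verticialInjective_holds`) by name: conditional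
exactly on Thm. 3.7 (iii) at `𝒢`, a verticial family, and the node data with (A3).
([IUTchI] Prop 2.2 p.45) [claim: Mochizuki2012, status: disputed] -/
theorem tp_isCommensurablyTerminal_ofProp36_at (hCV : CompactInVerticialAt 𝒢)
    (Λv : 𝒢.graph.Vertex →
      Subgroup (ofProp36 𝒢 h37.toProp36Hypotheses Sigma SigmaHat hsub hne hprime TpH HatH hle).Tp)
    (hΛv : ∀ v, Λv v ∈ verticialSubgroups (𝒢.temperedPiChart h37.toProp36Hypotheses) v)
    {E : Type*} (src tgt : E → 𝒢.graph.Vertex)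
    (c₁ c₂ : E → (ofProp36 𝒢 h37.toProp36Hypotheses Sigma SigmaHat hsub hne hprime TpH HatH hle).Tp)
    (hA3 : letI D := ofProp36 𝒢 h37.toProp36Hypotheses Sigma SigmaHat hsub hne hprime TpH HatH hle
      ∀ (v w : 𝒢.graph.Vertex) (g h : D.Hat),
      MulAut.conj g • (Λv v).map D.ι ⊓ MulAut.conj h • (Λv w).map D.ι ≠ ⊥ →
        (v = w ∧ g⁻¹ * h ∈ (Λv v).map D.ι) ∨
        ∃ (e : E) (k : D.Hat), ∃ p ∈ (Λv (src e)).map D.ι, ∃ q ∈ (Λv (tgt e)).map D.ι,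
          (src e = v ∧ tgt e = w ∧ g = k * D.ι (c₁ e) * p ∧ h = k * D.ι (c₂ e) * q) ∨
          (src e = w ∧ tgt e = v ∧ h = k * D.ι (c₁ e) * p ∧ g = k * D.ι (c₂ e) * q)) :
    IsCommensurablyTerminal
      (ofProp36 𝒢 h37.toProp36Hypotheses Sigma SigmaHat hsub hne hprime TpH HatH hle).ι.range :=
  (ofProp36 𝒢 h37.toProp36Hypotheses Sigma SigmaHat hsub hne hprime TpH HatH hle).tp_isCommensurablyTerminal_of_chart_of_isProfiniteCompletion_at
    (𝒢.temperedPiChart h37.toProp36Hypotheses)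
    (@id ((ofProp36 𝒢 h37.toProp36Hypotheses Sigma SigmaHat hsub hne hprime TpH HatH hle).Tp ≃ₜ*
      (𝒢.temperedPiChart h37.toProp36Hypotheses).G) (ContinuousMulEquiv.refl _)) h37 hCV verticialInjective_holds
    (ofProp36_isProfiniteCompletion 𝒢 h37.toProp36Hypotheses Sigma SigmaHat hsub hne hprime TpH HatH hle)
    (galoisDomination_of_prop36 h37.toProp36Hypotheses) Λv
    (fun v => by
      rw [map_reflEquiv_ofProp36 𝒢 h37 Sigma SigmaHat hsub hne hprime TpH HatH hle (Λv v)]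
      exact hΛv v) src tgt c₁ c₂ hA3

end TemperedGraphGroupData

end Literature.IUT.HodgeTheaters

end
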